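import Literature.MeasureTheory.Integral.TiltedAnticoncentration

/-!
# Stub `stub_fibreBandLaw` of crux `PauliWegnerSea.FMClosureUnquenched` (stmt-QuantumFields-11512) — Aux 2

Line `von-mises-circles`, seat c1 (circle-transport shortcut): the ABSTRACT CORE of the fibre band
law.  On a compact probability space charging open sets, let `FQ, FP ≥ 0` be continuous amplitudes and
`w > 0` a continuous weight with the DENSITY BOUND `w ≤ K ∫ w` (`K ≥ 1`), and suppose the RELATIVE
SMALL BALLS `μ{G ≤ ε G(x₀)} ≤ C_R ε^c` for `G ∈ {FQ, FP, FQ·FP}`.  Then, under the tilted law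
`ν ∝ w · FP dμ` (`FP ≢ 0`):

* (AE) `FQ ≢ 0 ⇒ FQ ≠ 0` `μ`-a.e. (small balls at `ε → 0`);
* (Flat) `FQ(x₀) ≤ Cf K^{1/c} · E_ν FQ` — flatness of `FQ·FP` under `w dμ`
  (`Literature.MeasureTheory.Integral.flatness_and_smallBalls_of_anticoncentration`) at a point where
  both `FQ > sup FQ / q` and `FP > sup FP / q` (it exists: the two deep sublevel sets have total mass
  `≤ 1/2` once `C_R q^{-c} ≤ 1/4`), and `∫ w FP ≤ sup FP ∫ w`;
* (Neg) for `0 < s ≤ c/2`: `FQ^{-s} w FP` is integrable and `E_ν FQ^{-s} ≤ Cn K^{1+1/c} (sup FQ)^{-s}` —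
  tilted small balls `ν{FQ ≤ ε sup FQ} ≤ K C_R · 2(2KC_R+1)^{1/c} ε^c` (density bound + flatness of `FP`)
  summed over the dyadic shells `{FQ ≤ 2^{-j} sup FQ}` (monotone convergence); the zeros of `FQ` are
  invisible (`0^{-s} = 0`).

Constants: `Cf = 2(2C_R+1)^{1/c} (4C_R+1)^{2/c}`, `Cn = C_R · 2(2C_R+1)^{1/c} · 2^{c/2}/(1-2^{-c/2}) + 1`.
Folklore (Laplace-type anti-concentration; layer-cake summation).
-/

noncomputable section

namespace Summit.QuantumFields.QCD.Theorems.VonMisesCirclesC1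

open scoped BigOperators ENNReal
open MeasureTheory Set Filter

/-- Small balls at every scale kill the zero set: `μ{F = 0} = 0` as soon as `F ≢ 0`. -/
private theorem ae_ne_zero_of_smallBalls {X : Type*} [MeasurableSpace X] (μ : Measure X)
    [IsFiniteMeasure μ] {F : X → ℝ} (hF0 : ∀ x, 0 ≤ F x) {C_R c : ℝ} (hc : 0 < c)
    (hR : ∀ x₀, 0 < F x₀ → ∀ ε : ℝ, 0 < ε → (μ {x | F x ≤ ε * F x₀}).toReal ≤ C_R * ε ^ c)
    (h : ∃ x, F x ≠ 0) : ∀ᵐ x ∂μ, F x ≠ 0 := by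
  obtain ⟨x₀, hx₀⟩ := h
  have hx₀' : 0 < F x₀ := lt_of_le_of_ne (hF0 x₀) (Ne.symm hx₀)
  have hle : ∀ ε : ℝ, 0 < ε → (μ {x | F x = 0}).toReal ≤ C_R * ε ^ c := by
    intro ε hε
    refine le_trans ?_ (hR x₀ hx₀' ε hε)
    refine ENNReal.toReal_mono (measure_ne_top _ _) (measure_mono fun x hx => ?_)
    show F x ≤ ε * F x₀
    rw [show F x = 0 from hx]; positivity
  have h0 : (μ {x | F x = 0}).toReal ≤ 0 := by
    refine le_of_forall_pos_le_add fun δ hδ => ?_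
    rw [zero_add]
    have hq : 0 < δ / (|C_R| + 1) := by positivity
    set ε : ℝ := (δ / (|C_R| + 1)) ^ c⁻¹ with hε
    have hεpos : 0 < ε := Real.rpow_pos_of_pos hq _
    have hεc : ε ^ c = δ / (|C_R| + 1) := by rw [hε, Real.rpow_inv_rpow hq.le hc.ne']
    refine (hle ε hεpos).trans ?_
    rw [hεc]
    have h1 : C_R * (δ / (|C_R| + 1)) ≤ |C_R| * (δ / (|C_R| + 1)) :=
      mul_le_mul_of_nonneg_right (le_abs_self _) hq.le
    have h2 : |C_R| * (δ / (|C_R| + 1)) < δ := by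
      rw [mul_div_assoc', div_lt_iff₀ (by positivity)]; nlinarith [abs_nonneg C_R]
    linarith
  have hzero : μ {x | F x = 0} = 0 := by
    rcases (ENNReal.toReal_eq_zero_iff _).1 (le_antisymm h0 ENNReal.toReal_nonneg) with h | h
    · exact h
    · exact absurd h (measure_ne_top _ _)
  rw [ae_iff]
  simpa only [ne_eq, not_not] using hzero

/-- **Negative moments from tilted small balls (layer cake).**  If `0 ≤ f ≤ M`, `0 < M`, `v ≥ 0` is
integrable and `∫_{f ≤ εM} v ≤ B ε^c` for every `ε > 0`, then for `0 < s ≤ c/2` the function `f^{-s} v`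
is integrable and `∫ f^{-s} v ≤ B · 2^{c/2}/(1 - 2^{-c/2}) · M^{-s}` (sum over the dyadic shells
`2^{-(j+1)} M < f ≤ 2^{-j} M`; the zero set of `f` does not contribute since `0^{-s} = 0`). -/
private theorem negMoment_of_smallBalls {X : Type*} [TopologicalSpace X] [MeasurableSpace X]
    [OpensMeasurableSpace X] (μ : Measure X) [IsFiniteMeasure μ] {f v : X → ℝ}
    (hf : Continuous f) (hv : Continuous v) (hvi : Integrable v μ)
    (hf0 : ∀ x, 0 ≤ f x) {M : ℝ} (hM : 0 < M) (hfM : ∀ x, f x ≤ M) (hv0 : ∀ x, 0 ≤ v x)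
    {B c : ℝ} (hB : 0 ≤ B)
    (hsb : ∀ ε : ℝ, 0 < ε → ∫ x in {x | f x ≤ ε * M}, v x ∂μ ≤ B * ε ^ c)
    {s : ℝ} (hs : 0 < s) (hsc : s ≤ c / 2) :
    Integrable (fun x => f x ^ (-s) * v x) μ ∧
      ∫ x, f x ^ (-s) * v x ∂μ ≤ B * ((2 : ℝ) ^ (c / 2) / (1 - (2 : ℝ) ^ (-(c / 2)))) * M ^ (-s) := by
  -- constants
  set ρ : ℝ := (2 : ℝ) ^ (-(c / 2)) with hρ
  have hρpos : 0 < ρ := Real.rpow_pos_of_pos two_pos _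
  have hρ1 : ρ < 1 := Real.rpow_lt_one_of_one_lt_of_neg one_lt_two (by linarith)
  set L : ℝ := (2 : ℝ) ^ (c / 2) * B * M ^ (-s) with hL
  have hL0 : 0 ≤ L := by positivity
  -- the dyadic pieces
  set Sj : ℕ → Set X := fun j => {x | f x ≤ (1 / 2 : ℝ) ^ j * M} with hSj
  have hSmeas : ∀ j, MeasurableSet (Sj j) := fun j =>
    (isClosed_le hf continuous_const).measurableSet
  set a : ℕ → ℝ := fun j => ((1 / 2 : ℝ) ^ (j + 1) * M) ^ (-s) with ha
  have ha0 : ∀ j, 0 ≤ a j := fun j => Real.rpow_nonneg (by positivity) _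
  set T : ℕ → X → ℝ≥0∞ := fun j x =>
    ENNReal.ofReal (a j) * (Sj j).indicator (fun x => ENNReal.ofReal (v x)) x with hT
  have hvm : Measurable fun x => ENNReal.ofReal (v x) := hv.measurable.ennreal_ofReal
  have hTm : ∀ j, Measurable (T j) := fun j => (hvm.indicator (hSmeas j)).const_mul _
  -- arithmetic of one piece: `a_j · B 2^{-jc} ≤ L ρ^j`
  have hu : ∀ (n : ℕ) (t : ℝ), ((1 / 2 : ℝ) ^ n) ^ t = (2 : ℝ) ^ (-((n : ℝ) * t)) := by
    intro n t
    rw [one_div, inv_pow, Real.inv_rpow (by positivity), ← Real.rpow_natCast,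
      ← Real.rpow_mul (by norm_num : (0 : ℝ) ≤ 2), Real.rpow_neg (by norm_num : (0 : ℝ) ≤ 2)]
  have harith : ∀ j : ℕ, a j * (B * ((1 / 2 : ℝ) ^ j) ^ c) ≤ L * ρ ^ j := by
    intro j
    have hρj : ρ ^ j = (2 : ℝ) ^ (-(c / 2) * j) := by
      rw [hρ, ← Real.rpow_natCast, ← Real.rpow_mul (by norm_num : (0 : ℝ) ≤ 2)]
    have haj : a j = (2 : ℝ) ^ (-(((j + 1 : ℕ) : ℝ) * (-s))) * M ^ (-s) := by
      rw [ha]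
      show ((1 / 2 : ℝ) ^ (j + 1) * M) ^ (-s) = _
      rw [Real.mul_rpow (by positivity) hM.le, hu]
    have hjs : 0 ≤ (j : ℝ) * (c / 2 - s) := mul_nonneg (Nat.cast_nonneg j) (by linarith)
    have hexp : (2 : ℝ) ^ (-(((j + 1 : ℕ) : ℝ) * (-s))) * (2 : ℝ) ^ (-((j : ℝ) * c)) ≤
        (2 : ℝ) ^ (c / 2) * (2 : ℝ) ^ (-(c / 2) * j) := by
      rw [← Real.rpow_add two_pos, ← Real.rpow_add two_pos]
      refine Real.rpow_le_rpow_of_exponent_le one_le_two ?_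
      push_cast
      nlinarith
    have hMB : 0 ≤ M ^ (-s) * B := mul_nonneg (Real.rpow_nonneg hM.le _) hB
    rw [haj, hu, hρj, hL]
    calc (2 : ℝ) ^ (-(((j + 1 : ℕ) : ℝ) * (-s))) * M ^ (-s) * (B * (2 : ℝ) ^ (-((j : ℝ) * c)))
        = ((2 : ℝ) ^ (-(((j + 1 : ℕ) : ℝ) * (-s))) * (2 : ℝ) ^ (-((j : ℝ) * c))) * (M ^ (-s) * B) := by
          ring
      _ ≤ ((2 : ℝ) ^ (c / 2) * (2 : ℝ) ^ (-(c / 2) * j)) * (M ^ (-s) * B) :=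
          mul_le_mul_of_nonneg_right hexp hMB
      _ = (2 : ℝ) ^ (c / 2) * B * M ^ (-s) * (2 : ℝ) ^ (-(c / 2) * j) := by ring
  -- pointwise domination `f^{-s} v ≤ Σ_j T_j`
  have hpt : ∀ x, ENNReal.ofReal (f x ^ (-s) * v x) ≤ ∑' j, T j x := by
    intro x
    rcases (hf0 x).eq_or_lt with hfx | hfx
    · rw [← hfx, Real.zero_rpow (neg_ne_zero.2 hs.ne'), zero_mul, ENNReal.ofReal_zero]
      exact zero_le
    · have hy0 : 0 < f x / M := div_pos hfx hM
      have hy1 : f x / M ≤ 1 := (div_le_one hM).2 (hfM x)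
      obtain ⟨j, hj1, hj2⟩ := exists_nat_pow_near_of_lt_one hy0 hy1
        (by norm_num : (0 : ℝ) < 1 / 2) (by norm_num : (1 / 2 : ℝ) < 1)
      have hxS : x ∈ Sj j := by
        show f x ≤ (1 / 2 : ℝ) ^ j * M
        exact (div_le_iff₀ hM).1 hj2
      have hlow : (1 / 2 : ℝ) ^ (j + 1) * M < f x := (lt_div_iff₀ hM).1 hj1
      have hpow : f x ^ (-s) ≤ a j :=
        Real.rpow_le_rpow_of_nonpos (by positivity) hlow.le (by linarith)
      calc ENNReal.ofReal (f x ^ (-s) * v x) ≤ ENNReal.ofReal (a j * v x) :=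
            ENNReal.ofReal_le_ofReal (mul_le_mul_of_nonneg_right hpow (hv0 x))
        _ = T j x := by
            rw [hT]
            show _ = ENNReal.ofReal (a j) * (Sj j).indicator (fun x => ENNReal.ofReal (v x)) x
            rw [Set.indicator_of_mem hxS, ENNReal.ofReal_mul (ha0 j)]
        _ ≤ ∑' i, T i x := ENNReal.le_tsum j
  -- integral of one piece
  have hpiece : ∀ j, ∫⁻ x, T j x ∂μ ≤ ENNReal.ofReal (L * ρ ^ j) := by
    intro j
    have h1 : ∫⁻ x, T j x ∂μ = ENNReal.ofReal (a j) * ∫⁻ x in Sj j, ENNReal.ofReal (v x) ∂μ := by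
      rw [hT]
      show ∫⁻ x, ENNReal.ofReal (a j) * (Sj j).indicator (fun x => ENNReal.ofReal (v x)) x ∂μ = _
      rw [lintegral_const_mul _ (hvm.indicator (hSmeas j)), lintegral_indicator (hSmeas j)]
    have h2 : ∫⁻ x in Sj j, ENNReal.ofReal (v x) ∂μ = ENNReal.ofReal (∫ x in Sj j, v x ∂μ) :=
      (ofReal_integral_eq_lintegral_ofReal hvi.integrableOn
        (Eventually.of_forall fun x => hv0 x)).symm
    rw [h1, h2, ← ENNReal.ofReal_mul (ha0 j)]
    refine ENNReal.ofReal_le_ofReal ((mul_le_mul_of_nonneg_left ?_ (ha0 j)).trans (harith j))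
    exact hsb ((1 / 2 : ℝ) ^ j) (by positivity)
  -- summation (monotone convergence)
  have hsum : HasSum (fun j : ℕ => L * ρ ^ j) (L * (1 - ρ)⁻¹) :=
    (hasSum_geometric_of_lt_one hρpos.le hρ1).mul_left L
  have hlin : ∫⁻ x, ENNReal.ofReal (f x ^ (-s) * v x) ∂μ ≤ ENNReal.ofReal (L * (1 - ρ)⁻¹) := by
    calc ∫⁻ x, ENNReal.ofReal (f x ^ (-s) * v x) ∂μ ≤ ∫⁻ x, ∑' j, T j x ∂μ := lintegral_mono hpt
      _ = ∑' j, ∫⁻ x, T j x ∂μ := lintegral_tsum fun j => (hTm j).aemeasurable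
      _ ≤ ∑' j, ENNReal.ofReal (L * ρ ^ j) := ENNReal.tsum_le_tsum hpiece
      _ = ENNReal.ofReal (L * (1 - ρ)⁻¹) := by
          rw [← ENNReal.ofReal_tsum_of_nonneg (fun j => by positivity) hsum.summable, hsum.tsum_eq]
  -- conclusion
  have hmeas : AEStronglyMeasurable (fun x => f x ^ (-s) * v x) μ :=
    ((hf.measurable.pow_const (-s)).mul hv.measurable).aestronglyMeasurable
  have hnn : 0 ≤ᵐ[μ] fun x => f x ^ (-s) * v x :=
    Eventually.of_forall fun x => mul_nonneg (Real.rpow_nonneg (hf0 x) _) (hv0 x)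
  have hint : Integrable (fun x => f x ^ (-s) * v x) μ := by
    refine ⟨hmeas, ?_⟩
    rw [hasFiniteIntegral_iff_ofReal hnn]
    exact lt_of_le_of_lt hlin ENNReal.ofReal_lt_top
  refine ⟨hint, ?_⟩
  rw [integral_eq_lintegral_of_nonneg_ae hnn hmeas]
  refine ENNReal.toReal_le_of_le_ofReal (by positivity) (hlin.trans_eq ?_)
  congr 1
  rw [hL]; field_simp

/-- **Abstract core of the fibre band law.**  See the module docstring: (AE), (Flat) and (Neg) for
continuous `FQ ≥ 0` under the tilted law `∝ w·FP dμ` on a compact probability space charging open sets,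
from the density bound `w ≤ K ∫ w` and relative small balls for `FQ`, `FP`, `FQ·FP`, with constants
`Cf K^{1/c}`, `Cn K^{1+1/c}` (`Cf`, `Cn` depending on `C_R`, `c` only) and `s₀ = c/2`. -/
theorem c1_fibreBandLaw_core : ∀ (C_R c : ℝ), 0 ≤ C_R → 0 < c →
    ∃ Cf Cn : ℝ, 0 < Cf ∧ 0 < Cn ∧
    ∀ (X : Type) [TopologicalSpace X] [CompactSpace X] [MeasurableSpace X] [BorelSpace X]
      (μ : MeasureTheory.Measure X) [MeasureTheory.IsProbabilityMeasure μ] [μ.IsOpenPosMeasure]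
      (FQ FP w : X → ℝ),
      Continuous FQ → Continuous FP → Continuous w →
      (∀ x, 0 ≤ FQ x) → (∀ x, 0 ≤ FP x) → (∀ x, 0 < w x) →
      ∀ K : ℝ, 1 ≤ K → (∀ x, w x ≤ K * ∫ y, w y ∂μ) →
      (∀ x₀, 0 < FQ x₀ → ∀ ε : ℝ, 0 < ε → (μ {x | FQ x ≤ ε * FQ x₀}).toReal ≤ C_R * ε ^ c) →
      (∀ x₀, 0 < FP x₀ → ∀ ε : ℝ, 0 < ε → (μ {x | FP x ≤ ε * FP x₀}).toReal ≤ C_R * ε ^ c) →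
      (∀ x₀, 0 < FQ x₀ * FP x₀ → ∀ ε : ℝ, 0 < ε →
          (μ {x | FQ x * FP x ≤ ε * (FQ x₀ * FP x₀)}).toReal ≤ C_R * ε ^ c) →
      (∃ x, FP x ≠ 0) →
      ((∃ x, FQ x ≠ 0) → ∀ᵐ x ∂μ, FQ x ≠ 0) ∧
      (∀ x₀, FQ x₀ ≤ Cf * K ^ (1 / c) * ((∫ x, FQ x * (w x * FP x) ∂μ) / ∫ x, w x * FP x ∂μ)) ∧
      (∀ s : ℝ, 0 < s → s ≤ c / 2 →
        MeasureTheory.Integrable (fun x => FQ x ^ (-s) * (w x * FP x)) μ ∧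
        (∫ x, FQ x ^ (-s) * (w x * FP x) ∂μ) / (∫ x, w x * FP x ∂μ) ≤
          Cn * K ^ (1 + 1 / c) * (⨆ x, FQ x) ^ (-s)) := by
  intro C_R c hCR hc
  set a₁ : ℝ := 2 * (2 * C_R + 1) ^ (1 / c) with ha₁
  set q : ℝ := (4 * C_R + 1) ^ (1 / c) with hq
  set Cneg : ℝ := (2 : ℝ) ^ (c / 2) / (1 - (2 : ℝ) ^ (-(c / 2))) with hCneg
  have ha₁pos : 0 < a₁ := by positivity
  have hqpos : 0 < q := Real.rpow_pos_of_pos (by positivity) _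
  have hρ1 : (2 : ℝ) ^ (-(c / 2)) < 1 := Real.rpow_lt_one_of_one_lt_of_neg one_lt_two (by linarith)
  have hCnegpos : 0 < Cneg := div_pos (Real.rpow_pos_of_pos two_pos _) (by linarith)
  refine ⟨a₁ * q ^ 2, C_R * a₁ * Cneg + 1, by positivity, by positivity, ?_⟩
  intro X _ _ _ _ μ _ _ FQ FP w hFQ hFP hw hFQ0 hFP0 hw0 K hK hdens hRQ hRP hRQP hP
  obtain ⟨xP, hxP⟩ := hP
  haveI : Nonempty X := ⟨xP⟩
  have hK0 : 0 < K := by linarith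
  -- integrability and positivity of integrals of continuous functions
  have hint : ∀ {g : X → ℝ}, Continuous g → Integrable g μ := fun {g} hg => by
    obtain ⟨C, hC⟩ := isCompact_univ.exists_bound_of_continuousOn hg.continuousOn
    exact (integrable_const C).mono' hg.aestronglyMeasurable
      (Eventually.of_forall fun x => hC x (mem_univ x))
  have hpos : ∀ {g : X → ℝ}, Continuous g → (∀ x, 0 ≤ g x) → ∀ x₀, g x₀ ≠ 0 →
      0 < ∫ x, g x ∂μ := by
    intro g hg hg0 x₀ hx₀
    rw [integral_pos_iff_support_of_nonneg hg0 (hint hg)]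
    exact hg.isOpen_support.measure_pos μ ⟨x₀, hx₀⟩
  -- maxima
  obtain ⟨xq, -, hxq⟩ := isCompact_univ.exists_isMaxOn univ_nonempty hFQ.continuousOn
  obtain ⟨xp, -, hxp⟩ := isCompact_univ.exists_isMaxOn univ_nonempty hFP.continuousOn
  replace hxq : ∀ x, FQ x ≤ FQ xq := fun x => hxq (mem_univ x)
  replace hxp : ∀ x, FP x ≤ FP xp := fun x => hxp (mem_univ x)
  have hMP : 0 < FP xp := lt_of_lt_of_le (lt_of_le_of_ne (hFP0 xP) (Ne.symm hxP)) (hxp xP)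
  have hsup : (⨆ x, FQ x) = FQ xq :=
    le_antisymm (ciSup_le hxq) (le_ciSup ⟨FQ xq, by rintro _ ⟨x, rfl⟩; exact hxq x⟩ xq)
  -- the integrals
  set Zw : ℝ := ∫ x, w x ∂μ with hZw_def
  set IP : ℝ := ∫ x, w x * FP x ∂μ with hIP_def
  have hZw : 0 < Zw := hpos hw (fun x => (hw0 x).le) xP (hw0 xP).ne'
  have hIP : 0 < IP := hpos (hw.mul hFP) (fun x => mul_nonneg (hw0 x).le (hFP0 x)) xP
    (mul_ne_zero (hw0 xP).ne' hxP)
  have hIPle : IP ≤ FP xp * Zw := by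
    rw [hIP_def, hZw_def, ← integral_const_mul]
    exact integral_mono (hint (hw.mul hFP)) ((hint hw).const_mul _) fun x =>
      show w x * FP x ≤ FP xp * w x by nlinarith [hxp x, (hw0 x).le]
  -- flatness under `w` for `FP` and `FQ·FP`
  have hA₁ : 2 * (2 * K * C_R + 1) ^ (1 / c) ≤ a₁ * K ^ (1 / c) := by
    have h1 : (2 * K * C_R + 1) ^ (1 / c) ≤ ((2 * C_R + 1) * K) ^ (1 / c) :=
      Real.rpow_le_rpow (by positivity) (by nlinarith) (by positivity)
    rw [Real.mul_rpow (by positivity) hK0.le] at h1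
    calc 2 * (2 * K * C_R + 1) ^ (1 / c) ≤ 2 * ((2 * C_R + 1) ^ (1 / c) * K ^ (1 / c)) := by
          linarith
      _ = a₁ * K ^ (1 / c) := by rw [ha₁]; ring
  have hflatP := (Literature.MeasureTheory.Integral.flatness_and_smallBalls_of_anticoncentration μ
    hFP hw hFP0 (fun x => (hw0 x).le) hK0.le hCR hc hZw hdens hRP).1
  have hflatQP := (Literature.MeasureTheory.Integral.flatness_and_smallBalls_of_anticoncentration μ
    (F := fun x => FQ x * FP x) (hFQ.mul hFP) hw (fun x => mul_nonneg (hFQ0 x) (hFP0 x))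
    (fun x => (hw0 x).le) hK0.le hCR hc hZw hdens hRQP).1
  -- the deep-sublevel parameter `1/q`: `C_R q^{-c} ≤ 1/4`
  have hqc' : q ^ c = 4 * C_R + 1 := by
    rw [hq, one_div, Real.rpow_inv_rpow (by positivity) hc.ne']
  have hqc : C_R * q⁻¹ ^ c ≤ 1 / 4 := by
    rw [Real.inv_rpow hqpos.le, hqc', ← div_eq_mul_inv, div_le_iff₀ (by positivity)]; linarith
  refine ⟨fun hQ => ae_ne_zero_of_smallBalls μ hFQ0 hc hRQ hQ, ?_, ?_⟩
  · -- (Flat)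
    intro x₀
    set J : ℝ := ∫ x, FQ x * (w x * FP x) ∂μ with hJ_def
    have hJ0 : 0 ≤ J :=
      integral_nonneg fun x => mul_nonneg (hFQ0 x) (mul_nonneg (hw0 x).le (hFP0 x))
    rcases (hFQ0 xq).eq_or_lt with hMQ | hMQ
    · have : FQ x₀ = 0 := le_antisymm (hMQ ▸ hxq x₀) (hFQ0 x₀)
      rw [this]
      exact mul_nonneg (by positivity) (div_nonneg hJ0 hIP.le)
    -- a point where both `FQ` and `FP` are within a factor `q` of their maxima
    obtain ⟨x₁, hx₁Q, hx₁P⟩ : ∃ x₁, q⁻¹ * FQ xq < FQ x₁ ∧ q⁻¹ * FP xp < FP x₁ := by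
      by_contra hcon
      push Not at hcon
      have hcov : {x | FQ x ≤ q⁻¹ * FQ xq} ∪ {x | FP x ≤ q⁻¹ * FP xp} = univ := by
        refine eq_univ_of_forall fun x => ?_
        rcases le_or_gt (FQ x) (q⁻¹ * FQ xq) with h | h
        · exact Or.inl h
        · exact Or.inr (hcon x h)
      have h1 : (μ {x | FQ x ≤ q⁻¹ * FQ xq}).toReal ≤ 1 / 4 :=
        (hRQ xq hMQ _ (inv_pos.2 hqpos)).trans hqc
      have h2 : (μ {x | FP x ≤ q⁻¹ * FP xp}).toReal ≤ 1 / 4 :=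
        (hRP xp hMP _ (inv_pos.2 hqpos)).trans hqc
      have h3 : (1 : ℝ≥0∞) ≤ μ {x | FQ x ≤ q⁻¹ * FQ xq} + μ {x | FP x ≤ q⁻¹ * FP xp} := by
        rw [← measure_univ (μ := μ), ← hcov]; exact measure_union_le _ _
      have h4 : (1 : ℝ) ≤
          (μ {x | FQ x ≤ q⁻¹ * FQ xq}).toReal + (μ {x | FP x ≤ q⁻¹ * FP xp}).toReal := by
        rw [← ENNReal.toReal_add (measure_ne_top _ _) (measure_ne_top _ _), ← ENNReal.toReal_one]
        exact ENNReal.toReal_mono (ENNReal.add_ne_top.2 ⟨measure_ne_top _ _, measure_ne_top _ _⟩) h3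
      linarith
    have hG₁ : q⁻¹ * FQ xq * (q⁻¹ * FP xp) < FQ x₁ * FP x₁ :=
      mul_lt_mul'' hx₁Q hx₁P (by positivity) (by positivity)
    have hJ' : ∫ x, FQ x * FP x * w x ∂μ = J :=
      integral_congr_ae (Eventually.of_forall fun x => by ring)
    have hflat₁ : FQ x₁ * FP x₁ ≤ 2 * (2 * K * C_R + 1) ^ (1 / c) * (J / Zw) := by
      have h : FQ x₁ * FP x₁ ≤
          2 * (2 * K * C_R + 1) ^ (1 / c) * ((∫ x, FQ x * FP x * w x ∂μ) / Zw) := hflatQP x₁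
      rwa [hJ'] at h
    have h5 : q⁻¹ * FQ xq * (q⁻¹ * FP xp) < a₁ * K ^ (1 / c) * (J / Zw) :=
      hG₁.trans_le (hflat₁.trans (mul_le_mul_of_nonneg_right hA₁ (div_nonneg hJ0 hZw.le)))
    have h6 : FQ xq * FP xp * Zw ≤ q ^ 2 * (a₁ * K ^ (1 / c)) * J := by
      have h := (mul_lt_mul_of_pos_right h5 (show 0 < q ^ 2 * Zw by positivity)).le
      have e1 : q⁻¹ * FQ xq * (q⁻¹ * FP xp) * (q ^ 2 * Zw) = FQ xq * FP xp * Zw := by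
        field_simp
      have e2 : a₁ * K ^ (1 / c) * (J / Zw) * (q ^ 2 * Zw) = q ^ 2 * (a₁ * K ^ (1 / c)) * J := by
        field_simp
      rwa [e1, e2] at h
    have h7 : FQ xq * IP ≤ q ^ 2 * (a₁ * K ^ (1 / c)) * J :=
      (mul_le_mul_of_nonneg_left hIPle (hFQ0 xq)).trans (by rw [← mul_assoc]; exact h6)
    calc FQ x₀ ≤ FQ xq := hxq x₀
      _ ≤ q ^ 2 * (a₁ * K ^ (1 / c)) * J / IP := (le_div_iff₀ hIP).2 h7
      _ = a₁ * q ^ 2 * K ^ (1 / c) * (J / IP) := by ring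
  · -- (Neg)
    intro s hs hsc
    rcases (hFQ0 xq).eq_or_lt with hMQ | hMQ
    · have h0 : ∀ x, FQ x = 0 := fun x => le_antisymm (hMQ ▸ hxq x) (hFQ0 x)
      have hfun : (fun x => FQ x ^ (-s) * (w x * FP x)) = fun _ => 0 := by
        funext x; rw [h0 x, Real.zero_rpow (neg_ne_zero.2 hs.ne'), zero_mul]
      rw [hfun, hsup, ← hMQ, Real.zero_rpow (neg_ne_zero.2 hs.ne'), integral_zero, zero_div,
        mul_zero]
      exact ⟨integrable_zero _ _ _, le_rfl⟩
    -- tilted small balls for `FQ` under `w·FP`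
    have hmass : ∀ t : ℝ, ∫ x in {x | FQ x ≤ t}, w x ∂μ ≤ K * Zw * (μ {x | FQ x ≤ t}).toReal := by
      intro t
      have hmeas : MeasurableSet {x | FQ x ≤ t} := (isClosed_le hFQ continuous_const).measurableSet
      calc ∫ x in {x | FQ x ≤ t}, w x ∂μ ≤ ∫ x in {x | FQ x ≤ t}, K * Zw ∂μ :=
            setIntegral_mono_on (hint hw).integrableOn integrableOn_const hmeas fun x _ => hdens x
        _ = K * Zw * (μ {x | FQ x ≤ t}).toReal := by
            rw [setIntegral_const, smul_eq_mul, mul_comm]; rfl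
    have hMPZ : FP xp * Zw ≤ a₁ * K ^ (1 / c) * IP := by
      have hIP' : ∫ x, FP x * w x ∂μ = IP :=
        integral_congr_ae (Eventually.of_forall fun x => by ring)
      have h : FP xp ≤ 2 * (2 * K * C_R + 1) ^ (1 / c) * ((∫ x, FP x * w x ∂μ) / Zw) :=
        hflatP xp
      rw [hIP'] at h
      have h' := h.trans (mul_le_mul_of_nonneg_right hA₁ (div_nonneg hIP.le hZw.le))
      rw [← mul_div_assoc, le_div_iff₀ hZw] at h'
      exact h'
    set B : ℝ := K * C_R * (a₁ * K ^ (1 / c) * IP) with hB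
    have hB0 : 0 ≤ B := by positivity
    have hsb : ∀ ε : ℝ, 0 < ε →
        ∫ x in {x | FQ x ≤ ε * FQ xq}, w x * FP x ∂μ ≤ B * ε ^ c := by
      intro ε hε
      have hmeas : MeasurableSet {x | FQ x ≤ ε * FQ xq} :=
        (isClosed_le hFQ continuous_const).measurableSet
      calc ∫ x in {x | FQ x ≤ ε * FQ xq}, w x * FP x ∂μ
          ≤ ∫ x in {x | FQ x ≤ ε * FQ xq}, FP xp * w x ∂μ :=
            setIntegral_mono_on (hint (hw.mul hFP)).integrableOn
              ((hint hw).const_mul _).integrableOn hmeas fun x _ => by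
                nlinarith [hxp x, (hw0 x).le]
        _ = FP xp * ∫ x in {x | FQ x ≤ ε * FQ xq}, w x ∂μ := integral_const_mul _ _
        _ ≤ FP xp * (K * Zw * (C_R * ε ^ c)) := by
            refine mul_le_mul_of_nonneg_left ((hmass _).trans ?_) hMP.le
            exact mul_le_mul_of_nonneg_left (hRQ xq hMQ ε hε) (by positivity)
        _ = K * C_R * (FP xp * Zw) * ε ^ c := by ring
        _ ≤ K * C_R * (a₁ * K ^ (1 / c) * IP) * ε ^ c := by gcongr
        _ = B * ε ^ c := by rw [hB]
    obtain ⟨hI, hle⟩ := negMoment_of_smallBalls μ hFQ (hw.mul hFP) (hint (hw.mul hFP)) hFQ0 hMQ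
      hxq (fun x => mul_nonneg (hw0 x).le (hFP0 x)) hB0 hsb hs hsc
    refine ⟨hI, ?_⟩
    rw [div_le_iff₀ hIP, hsup]
    refine hle.trans ?_
    have hKpow : K * K ^ (1 / c) = K ^ (1 + 1 / c) := by
      rw [Real.rpow_add hK0, Real.rpow_one]
    have hMQs : 0 ≤ FQ xq ^ (-s) := Real.rpow_nonneg (hFQ0 xq) _
    have hKs : 0 ≤ K ^ (1 + 1 / c) := Real.rpow_nonneg hK0.le _
    calc B * ((2 : ℝ) ^ (c / 2) / (1 - (2 : ℝ) ^ (-(c / 2)))) * FQ xq ^ (-s)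
        = C_R * a₁ * Cneg * K ^ (1 + 1 / c) * FQ xq ^ (-s) * IP := by
          rw [hB, ← hKpow, hCneg]; ring
      _ ≤ (C_R * a₁ * Cneg + 1) * K ^ (1 + 1 / c) * FQ xq ^ (-s) * IP := by
          have : C_R * a₁ * Cneg ≤ C_R * a₁ * Cneg + 1 := by linarith
          gcongr

end Summit.QuantumFields.QCD.Theorems.VonMisesCirclesC1
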